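import Summits.QuantumFields.YangMills.Theses.TypicalExteriorCeilings
import Summits.QuantumFields.YangMills.Theorems.OnsetCalibrationCollarTransfer

/-!
# Route `TypicalExteriorCeilings` — support `HolderTransfer` (stmt-QuantumFields-25893): the ANNEALED boundary law collars to
# factorial-tolerant sub-onset ceilings

Seat `ym-line-sfw-p1` g12 (2026-08-28).  Rung R2a-IV is a RECORD-label rung (leaf `HypercubicOSDataFromInfiniteVolume`); this module is
DLR bookkeeping + AM–GM and proves no boundary law, no ceiling from first principles, and no summit; the Yang–Mills mass gap is NOT proved.

* §1 ★ `abs_integral_prod_sub_mean_le_of_moment` — the MOMENT-form twin of the tree's sup-form collar bound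
  `Literature.MathematicalPhysics.QuantumLattice.abs_integral_prod_sub_mean_le` (Georgii Thm. 4.17: one torus-DLR step per site, the already
  collared kernel means and the raw far observables forming the far factor; SAME induction, the far factor now bounded by sup-norms only): if the
  `n`-th absolute moment of every collared kernel mean `hᵢ = γ_{Λᵢ}Aᵢ − ⟨Aᵢ⟩` in the torus state is `≤ Bⁿ`, then `|⟨∏ᵢ(Aᵢ − ⟨Aᵢ⟩)⟩| ≤ Bⁿ` —
  the finish is AM–GM `∏ᵢ|hᵢ| ≤ n⁻¹ Σᵢ |hᵢ|ⁿ` (equal moment budgets, so no Hölder bookkeeping and no factor `2`).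
* §2 `momentCeilings_of_kernelMoments` — the same in the vocabulary of `OnsetCalibration.momentCeilings_of_boundaryOscillation` (cubes of side
  `2R+3` around `n` sites pairwise `≥ 2R+4` apart on the odd torus, `4R+8 ≤ L`; geometry `isCylinder_plane_cube`, `injOn_torusProj_cube`,
  `torusEdge_ne_cube` from the tree).
* §3 ★★ `holderTransfer_proof : HolderTransfer` BY NAME: `ℓ₄ = ℓ₁/5` (so `(2R+3)s ≤ 5Rs ≤ ℓ₁`), `C`, `κ` unchanged, K1 used at `p = n`
  (`n = 0` is the empty product).
No definitions, no named facts, no `sorry`. [cite: OsterwalderSchrader1975, §2]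
-/

set_option autoImplicit false

noncomputable section

open scoped SchwartzMap
open MeasureTheory Filter Topology Finset
open Literature.Probability.LatticeModels
open Literature.MathematicalPhysics.QuantumFieldTheory (GaugeConfig Edge Plaquette wilsonMeasure isProbabilityMeasure_wilsonMeasure
  LatticeRep IsCompactSimpleLieGroup)
open Literature.MathematicalPhysics.QuantumLattice
open Summit.QuantumFields.YangMills.Cruxes.OSLegsFromFemtoAndGap.DlrCollarTransfer

namespace Summit.QuantumFields.YangMills.Theorems.TypicalExteriorCeilings

/-! ## §1 The collar bound in moment form (torus-DLR product + AM–GM) -/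

section Collar

variable {d N : ℕ} {G : Type*} [Group G] [TopologicalSpace G] [IsTopologicalGroup G]
  [CompactSpace G] [MeasurableSpace G] [BorelSpace G] [SecondCountableTopology G]
  (ρ : G →* Matrix (Fin N) (Fin N) ℂ)

omit [IsTopologicalGroup G] [CompactSpace G] [MeasurableSpace G] [BorelSpace G] [SecondCountableTopology G] in
/-- AM–GM for `n ≥ 1` factors: `∏_{i<n} |aᵢ| ≤ n⁻¹ Σ_{i<n} |aᵢ|ⁿ`. [folklore] -/
theorem prod_abs_le_inv_mul_sum_pow {n : ℕ} (hn : 1 ≤ n) (a : Fin n → ℝ) :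
    ∏ i, |a i| ≤ (n : ℝ)⁻¹ * ∑ i, |a i| ^ n := by
  have hn0 : n ≠ 0 := by omega
  have hnpos : (0 : ℝ) < n := by exact_mod_cast Nat.pos_of_ne_zero hn0
  have hw : ∑ _i : Fin n, (n : ℝ)⁻¹ = 1 := by
    rw [Finset.sum_const, Finset.card_univ, Fintype.card_fin, nsmul_eq_mul, mul_inv_cancel₀ hnpos.ne']
  have h := Real.geom_mean_le_arith_mean_weighted (Finset.univ : Finset (Fin n)) (fun _ => (n : ℝ)⁻¹) (fun i => |a i| ^ n)
    (fun _ _ => inv_nonneg.mpr hnpos.le) hw (fun i _ => pow_nonneg (abs_nonneg _) _)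
  have hl : ∏ i, (|a i| ^ n) ^ ((n : ℝ)⁻¹) = ∏ i, |a i| :=
    Finset.prod_congr rfl fun i _ => Real.pow_rpow_inv_natCast (abs_nonneg _) hn0
  rw [hl] at h
  rw [Finset.mul_sum]
  exact h

/-- ★ **Moment-form collar transfer.**  On the torus of side `L`, let `A₁, …, Aₙ` (`n ≥ 1`) be bounded continuous cylinder observables of
`ℤ^d` (supports `Sᵢ`) read through the periodic lift, and `Λ₁, …, Λₙ` finite link sets such that (i) each `Λᵢ ∪ Sᵢ ∪ ∂Λᵢ` injects into the
torus and (ii) for `i ≠ j` the torus images of `Sⱼ ∪ ∂Λⱼ` and of `Λᵢ` are disjoint.  If the collared kernel means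
`hᵢ(V) = (γ_{Λᵢ} Aᵢ)(lift V) − ⟨Aᵢ⟩` have `n`-th absolute moments `≤ Bⁿ` in the torus Wilson state (`B ≥ 0`), then
`|⟨∏ᵢ (Aᵢ − ⟨Aᵢ⟩)⟩| ≤ Bⁿ`.  Proof: the collar identity `⟨∏(Aᵢ − ⟨Aᵢ⟩)⟩ = ⟨∏ hᵢ⟩` exactly as in the tree's sup-form
`abs_integral_prod_sub_mean_le` (one DLR step per site, `integral_torusLift_mul_eq_integral_ymSpecification_mul`), then
`|⟨∏hᵢ⟩| ≤ ⟨∏|hᵢ|⟩ ≤ n⁻¹ Σᵢ ⟨|hᵢ|ⁿ⟩ ≤ Bⁿ` (AM–GM).  (Georgii 2011, Thm. 4.17; generalised Hölder replaced by AM–GM.) [folklore] -/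
theorem abs_integral_prod_sub_mean_le_of_moment (hρ : Continuous ρ) (β : ℝ) {L : ℕ} [NeZero L] {n : ℕ} (hn : 1 ≤ n)
    (Λ S : Fin n → Finset (ZdEdge d))
    (A : Fin n → LGConfig d G → ℝ) (hAc : ∀ i, Continuous (A i)) {CA : ℝ} (hAb : ∀ i U, |A i U| ≤ CA)
    (hAS : ∀ i, IsCylinder (A i) (S i))
    (hinj : ∀ i, Set.InjOn (Torus.proj L)
      ((Λ i ∪ S i ∪ (plaquettesTouching (Λ i)).biUnion plaquetteEdges).image Prod.fst : Set (Site d)))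
    (hfar : ∀ i j, i ≠ j → ∀ e ∈ S j ∪ (plaquettesTouching (Λ j)).biUnion plaquetteEdges, ∀ e' ∈ Λ i,
      torusEdge L e ≠ torusEdge L e')
    (m : Fin n → ℝ) (hm : ∀ i, m i = ∫ W, A i (torusLift L W) ∂(wilsonMeasure ρ β))
    {B : ℝ}
    (hmom : ∀ i, ∫ V, |(∫ U, A i U ∂(ymSpecification ρ β (Λ i) (torusLift L V))) - m i| ^ n ∂(wilsonMeasure ρ β) ≤ B ^ n) :
    |∫ V, ∏ i, (A i (torusLift L V) - m i) ∂(wilsonMeasure ρ β)| ≤ B ^ n := by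
  classical
  haveI := isProbabilityMeasure_wilsonMeasure (d := d) (L := L) ρ hρ β
  -- kernel means and collared observables
  set g : Fin n → LGConfig d G → ℝ := fun i η => ∫ U, A i U ∂(ymSpecification ρ β (Λ i) η) with hgdef
  set h : Fin n → LGConfig d G → ℝ := fun i η => g i η - m i with hhdef
  have hgcyl : ∀ i, IsCylinder (g i) (S i ∪ (plaquettesTouching (Λ i)).biUnion plaquetteEdges) := fun i =>
    dependsOn_integral_ymSpecification ρ hρ β (Λ i) (hAc i).measurable (hAS i)
  have hgc : ∀ i, Continuous (g i) := fun i =>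
    continuous_integral_ymSpecification ρ hρ β (Λ i) (hAc i) (hAb i)
  have hgb : ∀ i η, |g i η| ≤ CA := fun i η => abs_integral_ymSpecification_le ρ hρ β (Λ i) (hAb i) η
  have hmb : ∀ i, |m i| ≤ CA := fun i => by
    rw [hm i]
    exact abs_integral_le_of_abs_le fun W => hAb i _
  -- sup bound on the collared observables (only used for the far factors)
  have hhb : ∀ i η, |h i η| ≤ CA + CA := fun i η => by
    simp only [hhdef]
    exact (abs_sub _ _).trans (add_le_add (hgb i η) (hmb i))
  have hhcyl : ∀ i, IsCylinder (h i) (S i ∪ (plaquettesTouching (Λ i)).biUnion plaquetteEdges) :=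
    fun i U V hUV => by simp only [hhdef, hgcyl i hUV]
  have hhc : ∀ i, Continuous (h i) := fun i => (hgc i).sub continuous_const
  -- far factors do not feel the links over `Λ i`
  have hhfar : ∀ i j, i ≠ j → ∀ W V,
      h j (torusLift L (((Λ i).image (torusEdge L)).piecewise W V)) = h j (torusLift L V) :=
    fun i j hij W V => apply_torusLift_piecewise_eq (hhcyl j) (hfar i j hij) W V
  have hAfar : ∀ i j, i ≠ j → ∀ W V,
      A j (torusLift L (((Λ i).image (torusEdge L)).piecewise W V)) = A j (torusLift L V) :=
    fun i j hij W V => apply_torusLift_piecewise_eq (hAS j)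
      (fun e he => hfar i j hij e (Finset.mem_union_left _ he)) W V
  -- the collar identity, by induction on the set `T` of already collared sites
  have hcollar : ∀ T : Finset (Fin n),
      ∫ V, (∏ i ∈ T, h i (torusLift L V)) * ∏ i ∈ Tᶜ, (A i (torusLift L V) - m i)
          ∂(wilsonMeasure ρ β) =
        ∫ V, ∏ i, (A i (torusLift L V) - m i) ∂(wilsonMeasure ρ β) := by
    intro T
    induction T using Finset.induction_on with
    | empty => simp
    | @insert i T hiT ih =>
      rw [← ih]
      have hTc : Tᶜ = insert i (insert i T)ᶜ := (Finset.insert_compl_insert hiT).symm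
      have hi' : i ∉ (insert i T)ᶜ := fun hh => (Finset.mem_compl.1 hh) (Finset.mem_insert_self i T)
      rw [hTc]
      simp only [Finset.prod_insert hiT, Finset.prod_insert hi']
      -- the far factor of the DLR step at `i`
      set H : GaugeConfig d L G → ℝ := fun V =>
        (∏ j ∈ T, h j (torusLift L V)) * ∏ j ∈ (insert i T)ᶜ, (A j (torusLift L V) - m j) with hHdef
      have hHc : Continuous H :=
        (continuous_finsetProd T fun j _ => (hhc j).comp (continuous_torusLift L)).mul
          (continuous_finsetProd _ fun j _ =>
            ((hAc j).comp (continuous_torusLift L)).sub continuous_const)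
      have hHb : ∀ V, |H V| ≤ (∏ j ∈ T, (CA + CA)) * ∏ j ∈ (insert i T)ᶜ, (CA + |m j|) := fun V => by
        simp only [hHdef, abs_mul]
        refine mul_le_mul (abs_prod_le_prod T (f := fun j V => h j (torusLift L V)) (fun j _ V => hhb j _) V)
          (abs_prod_le_prod _ (f := fun j V => A j (torusLift L V) - m j)
            (fun j _ V => (abs_sub _ _).trans (add_le_add_left (hAb j _) _)) V)
          (abs_nonneg _) ?_
        exact Finset.prod_nonneg fun j _ => (abs_nonneg _).trans (hhb j (torusLift L V))
      have hHpw : ∀ W V, H (((Λ i).image (torusEdge L)).piecewise W V) = H V := by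
        intro W V
        simp only [hHdef]
        congr 1
        · exact Finset.prod_congr rfl fun j hj => hhfar i j (fun e => hiT (e ▸ hj)) W V
        · exact Finset.prod_congr rfl fun j hj => by rw [hAfar i j (fun e => hi' (e ▸ hj)) W V]
      have key := integral_torusLift_mul_eq_integral_ymSpecification_mul ρ hρ β (Λ i)
        (F := fun U => A i U - m i) ((hAc i).sub continuous_const) (C := CA + |m i|)
        (fun U => (abs_sub _ _).trans (add_le_add_left (hAb i U) _)) (S₀ := S i)
        (fun U V hUV => by simp only [hAS i hUV]) (hinj i) hHc.measurable hHb hHpw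
      have hkern : ∀ V, ∫ U, (A i U - m i) ∂(ymSpecification ρ β (Λ i) (torusLift L V)) =
          h i (torusLift L V) := by
        intro V
        haveI := isProbabilityMeasure_ymSpecification ρ hρ β (Λ i) (torusLift L V)
        simp only [hhdef, hgdef]
        exact integral_sub_const_of_abs_le (hAc i).measurable (hAb i) (m i)
      simp only [hkern] at key
      calc ∫ V, h i (torusLift L V) * (∏ j ∈ T, h j (torusLift L V)) *
              ∏ j ∈ (insert i T)ᶜ, (A j (torusLift L V) - m j) ∂(wilsonMeasure ρ β)
          = ∫ V, h i (torusLift L V) * H V ∂(wilsonMeasure ρ β) := by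
            refine integral_congr_ae (ae_of_all _ fun V => ?_)
            simp only [hHdef]
            ring
        _ = ∫ V, (A i (torusLift L V) - m i) * H V ∂(wilsonMeasure ρ β) := key.symm
        _ = ∫ V, (∏ j ∈ T, h j (torusLift L V)) * ((A i (torusLift L V) - m i) *
              ∏ j ∈ (insert i T)ᶜ, (A j (torusLift L V) - m j)) ∂(wilsonMeasure ρ β) := by
            refine integral_congr_ae (ae_of_all _ fun V => ?_)
            simp only [hHdef]
            ring
  -- conclusion: all sites collared, then AM–GM under the probability measure
  have hfin := hcollar Finset.univ
  simp only [Finset.compl_univ, Finset.prod_empty, mul_one] at hfin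
  rw [← hfin]
  have hmom' : ∀ i, ∫ V, |h i (torusLift L V)| ^ n ∂(wilsonMeasure ρ β) ≤ B ^ n := fun i => by
    simpa only [hhdef, hgdef] using hmom i
  -- integrability of the players (all bounded and continuous)
  have hIabs : ∀ i, Integrable (fun V => |h i (torusLift L V)| ^ n) (wilsonMeasure ρ β) := fun i =>
    integrable_of_abs_le (((continuous_abs.comp ((hhc i).comp (continuous_torusLift L))).pow n).measurable)
      (C := (CA + CA) ^ n) fun V => by
        rw [abs_pow, abs_abs]
        exact pow_le_pow_left₀ (abs_nonneg _) (hhb i _) n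
  have hIprod : Integrable (fun V => ∏ i, |h i (torusLift L V)|) (wilsonMeasure ρ β) :=
    integrable_of_abs_le ((continuous_finsetProd _ fun i _ =>
      continuous_abs.comp ((hhc i).comp (continuous_torusLift L))).measurable) (C := ∏ _i : Fin n, (CA + CA))
      fun V => by
        rw [Finset.abs_prod]
        exact Finset.prod_le_prod (fun i _ => abs_nonneg _) fun i _ => by rw [abs_abs]; exact hhb i _
  have hnR : (0 : ℝ) < n := by exact_mod_cast hn
  calc |∫ V, ∏ i, h i (torusLift L V) ∂(wilsonMeasure ρ β)|
      ≤ ∫ V, |∏ i, h i (torusLift L V)| ∂(wilsonMeasure ρ β) := by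
        simpa only [Real.norm_eq_abs] using norm_integral_le_integral_norm (fun V => ∏ i, h i (torusLift L V))
    _ = ∫ V, ∏ i, |h i (torusLift L V)| ∂(wilsonMeasure ρ β) := by
        refine integral_congr_ae (ae_of_all _ fun V => ?_)
        exact Finset.abs_prod _ _
    _ ≤ ∫ V, (n : ℝ)⁻¹ * ∑ i, |h i (torusLift L V)| ^ n ∂(wilsonMeasure ρ β) := by
        refine integral_mono hIprod ((integrable_finsetSum _ fun i _ => hIabs i).const_mul _) fun V => ?_
        exact prod_abs_le_inv_mul_sum_pow hn fun i => h i (torusLift L V)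
    _ = (n : ℝ)⁻¹ * ∑ i, ∫ V, |h i (torusLift L V)| ^ n ∂(wilsonMeasure ρ β) := by
        rw [integral_const_mul, integral_finsetSum _ fun i _ => hIabs i]
    _ ≤ (n : ℝ)⁻¹ * ∑ _i : Fin n, B ^ n := by
        exact mul_le_mul_of_nonneg_left (Finset.sum_le_sum fun i _ => hmom' i) (inv_nonneg.mpr hnR.le)
    _ = B ^ n := by
        rw [Finset.sum_const, Finset.card_univ, Fintype.card_fin, nsmul_eq_mul, ← mul_assoc, inv_mul_cancel₀ hnR.ne', one_mul]

end Collar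

/-! ## §2 The same on femto cubes around separated sites (vocabulary of `OnsetCalibration`) -/

/-- **Moment-form collar transfer on the odd torus `(ℤ/(2L+1))⁴`**: if at `n ≥ 1` sites, pairwise at torus distance `≥ 2R+4` in some
coordinate (`1 ≤ R`, `4R+8 ≤ L`), the `n`-th absolute moment IN THE TORUS STATE of (kernel mean of the single-plane field over the radius-`R+1`
cube around the site, as a function of the exterior) minus (its torus mean) is `≤ Bⁿ`, then the centred mixed moment of the `n` single-plane fields
is `≤ Bⁿ` in absolute value. [folklore] -/
theorem momentCeilings_of_kernelMoments {G : Type} [Group G] [TopologicalSpace G] [IsTopologicalGroup G]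
    [CompactSpace G] [MeasurableSpace G] [BorelSpace G] (r : LatticeRep G) {β B : ℝ}
    (L n : ℕ) (q : Fin n → Fin 4 × Fin 4) (x : Fin n → (Fin 4 → ℤ)) (R : ℕ) (hn : 1 ≤ n)
    (hR : 1 ≤ R) (hRL : 4 * R + 8 ≤ L)
    (hsep : ∀ i j : Fin n, i ≠ j → ∃ k : Fin 4,
      (2 * (R : ℤ) + 4) ≤ |((((x i k - x j k : ℤ) : ZMod (2 * L + 1))).valMinAbs : ℤ)|)
    (hmom : ∀ i : Fin n, torusE G r β L (fun V =>
      |kerE G r β (fun k => x i k - (R + 1)) (2 * R + 3) V (plane G r (q i) (x i)) - torusE G r β L (plane G r (q i) (x i))| ^ n) ≤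
        B ^ n) :
    |torusE G r β L (fun U => ∏ i, (plane G r (q i) (x i) U - torusE G r β L (plane G r (q i) (x i))))| ≤ B ^ n := by
  haveI : SecondCountableTopology G :=
    (r.continuous.isClosedEmbedding r.injective).isEmbedding.secondCountableTopology
  haveI := isProbabilityMeasure_wilsonMeasure (d := 4) (L := 2 * L + 1) r.ρ r.continuous β
  obtain ⟨CA, hCA⟩ := exists_abs_plane_le r
  have hAc : ∀ i : Fin n, Continuous (plane G r (q i) (x i)) := fun i => continuous_plane r (q i) (x i)
  have hAb : ∀ (i : Fin n) (U : LGConfig 4 G), |plane G r (q i) (x i) U| ≤ CA := fun i U => hCA _ _ _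
  have hAS : ∀ i : Fin n, IsCylinder (plane G r (q i) (x i)) (Summit.QuantumFields.YangMills.Cruxes.OSLegsFromFemtoAndGap.DlrCollarTransfer.cubeEdges (fun k => x i k - (R + 1)) (2 * R + 3)) :=
    fun i => isCylinder_plane_cube r hR (q i) (x i)
  have hinj : ∀ i : Fin n, Set.InjOn (Torus.proj (2 * L + 1))
      (((Summit.QuantumFields.YangMills.Cruxes.OSLegsFromFemtoAndGap.DlrCollarTransfer.cubeEdges (fun k => x i k - (R + 1)) (2 * R + 3) ∪ Summit.QuantumFields.YangMills.Cruxes.OSLegsFromFemtoAndGap.DlrCollarTransfer.cubeEdges (fun k => x i k - (R + 1)) (2 * R + 3) ∪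
          (plaquettesTouching (Summit.QuantumFields.YangMills.Cruxes.OSLegsFromFemtoAndGap.DlrCollarTransfer.cubeEdges (fun k => x i k - (R + 1)) (2 * R + 3))).biUnion plaquetteEdges).image
          Prod.fst : Set (Fin 4 → ℤ))) :=
    fun i => injOn_torusProj_cube hRL (x i)
  have hfar : ∀ i j : Fin n, i ≠ j →
      ∀ e ∈ Summit.QuantumFields.YangMills.Cruxes.OSLegsFromFemtoAndGap.DlrCollarTransfer.cubeEdges (fun k => x j k - (R + 1)) (2 * R + 3) ∪
        (plaquettesTouching (Summit.QuantumFields.YangMills.Cruxes.OSLegsFromFemtoAndGap.DlrCollarTransfer.cubeEdges (fun k => x j k - (R + 1)) (2 * R + 3))).biUnion plaquetteEdges,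
      ∀ e' ∈ Summit.QuantumFields.YangMills.Cruxes.OSLegsFromFemtoAndGap.DlrCollarTransfer.cubeEdges (fun k => x i k - (R + 1)) (2 * R + 3),
      torusEdge (2 * L + 1) e ≠ torusEdge (2 * L + 1) e' :=
    fun i j hij e he e' he' => torusEdge_ne_cube (hsep i j hij) he he'
  exact abs_integral_prod_sub_mean_le_of_moment (d := 4) r.ρ r.continuous β (L := 2 * L + 1) hn
    (fun i => Summit.QuantumFields.YangMills.Cruxes.OSLegsFromFemtoAndGap.DlrCollarTransfer.cubeEdges (fun k => x i k - (R + 1)) (2 * R + 3)) (fun i => Summit.QuantumFields.YangMills.Cruxes.OSLegsFromFemtoAndGap.DlrCollarTransfer.cubeEdges (fun k => x i k - (R + 1)) (2 * R + 3))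
    (fun i => plane G r (q i) (x i)) hAc hAb hAS hinj hfar (fun i => torusE G r β L (plane G r (q i) (x i))) (fun i => rfl) hmom

/-! ## §3 The item by name -/

/-- ★★ **`HolderTransfer` (stmt-QuantumFields-25893)**: `AnnealedBoundaryLaw` implies the factorial-tolerant sub-onset ceilings, with
`ℓ₄ = ℓ₁/5` and the SAME `C, κ` (K1 at `p = n`, moment-form collar transfer; `n = 0` is the empty product). [cite: OsterwalderSchrader1975, §2] -/
theorem holderTransfer_proof : Summit.QuantumFields.YangMills.Theses.TypicalExteriorCeilings.HolderTransfer := by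
  intro hK G _ _ _ _ hG hSU
  letI : MeasurableSpace G := borel G
  haveI : BorelSpace G := ⟨rfl⟩
  intro r v f g h Λ₅
  obtain ⟨ε₀, hε₀, hε⟩ := hK G hG hSU r v f g h Λ₅
  refine ⟨ε₀, hε₀, fun ε hε0 hεle hwin => ?_⟩
  obtain ⟨C, κ, ℓ₁, β₁, hℓ₁, hC, hκ, hmain⟩ := hε ε hε0 hεle hwin
  refine ⟨C, κ, ℓ₁ / 5, β₁, by positivity, hC, hκ, ?_⟩
  intro β hβ s hs0 hs1 hmax L n q x R hq hR hRs hRL hsep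
  have hmain' := hmain β hβ s hs0 hs1 hmax
  -- the cubes of side `2R+3` are femto in the unit `s`
  have hb : ((2 * R + 3 : ℕ) : ℝ) * s ≤ ℓ₁ := by
    have h5 : ((2 * R + 3 : ℕ) : ℝ) ≤ 5 * R := by
      have : (1 : ℝ) ≤ R := by exact_mod_cast hR
      push_cast
      linarith
    calc ((2 * R + 3 : ℕ) : ℝ) * s ≤ 5 * R * s := mul_le_mul_of_nonneg_right h5 hs0.le
      _ = 5 * ((R : ℝ) * s) := by ring
      _ ≤ 5 * (ℓ₁ / 5) := by gcongr
      _ = ℓ₁ := by ring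
  rcases Nat.eq_zero_or_pos n with hn0 | hnpos
  · subst hn0
    haveI : SecondCountableTopology G :=
      (r.continuous.isClosedEmbedding r.injective).isEmbedding.secondCountableTopology
    haveI := isProbabilityMeasure_wilsonMeasure (d := 4) (L := 2 * L + 1) r.ρ r.continuous β
    simp [torusE]
  · exact momentCeilings_of_kernelMoments r L n q x R hnpos hR hRL hsep
      fun i => hmain' L (q i) (x i) R n (hq i) hR hb hRL hnpos

end Summit.QuantumFields.YangMills.Theorems.TypicalExteriorCeilings

end
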